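import Mathlib.Analysis.SpecialFunctions.Log.Basic
import Summits.Ventures.CertifiedManyBodySolver.Downfold.ParameterBox
import HarnessLib

/-!
# Composition of inflation stages: a multiplicative pad (INFL-P) on top of a floored hull

Venture CertifiedManyBodySolver, cell `pub/hubbard-downfold` (stage S1 = downfolding front end),
seat hubbard-downfold-mod-2 (the BOX type: how named systematic widths combine); namespaces
`NonemptyInterval` (two dot-notation lemmas on mod-1's `floorTo`/`inflate`) and
`Summit.Ventures.CertifiedManyBodySolver.Downfold.Inflation`. Everything here is PROVED (elementary).
WHAT THIS IS NOT: a physical statement — which error sources exist and how large they are is the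
business of `pub/hubbard-downfold/router/INFLATION-RULES.md` (§P INFL-P: structure/pressure mismatch
as a multiplicative width `X ∈ X₀·[e^{-s}, e^{s}]`); this file only certifies HOW a pad composes with
the interval it is applied to (ROUTER v0.5 §4.3 BOX-WIDTH ALGEBRA; BOX-SCHEMA v0.1 R2/R3/C3:
`enclosure = pads(floorTo(hull, FLOOR))`).

* §1 `abs_log_sub_log_le_add` — widths of CONSECUTIVE stages add in log (method stage `F`, structure
  stage `s` ⇒ `F + s`); `exp_neg_le_of_abs_log_le` turns a log width into multiplicative bounds.
* §2 the multiplicative pad END-POINT-WISE: `mul_mem_Icc_mul` (`x ∈ [lo, hi]`, `ρ ∈ [ρlo, ρhi]`,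
  `0 ≤ lo`, `0 ≤ ρlo` ⇒ `xρ ∈ [lo ρlo, hi ρhi]`), its printed additive form `mul_mem_Icc_sub_add`
  (`minus ≥ lo (1 − ρlo)`, `plus ≥ hi (ρhi − 1)` — BOX-SCHEMA R3), and the one-radius bound
  `abs_mul_sub_self_le` (`|xρ − x| ≤ hi · max (1 − ρlo) (ρhi − 1)`).
* §3 `exists_mul_not_mem_Icc_max` — reading "FLOOR vs INFL-P: whichever is wider governs" as
  `midpoint ± max(F, p)` is NOT an enclosure rule: with a method error at the floor edge and a
  structure factor at the pad edge the product leaves `[1 − max F p, 1 + max F p]`; the composed,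
  end-point-wise interval does enclose (`mul_mem_Icc_composed`).
* §4 `NonemptyInterval.halfWidth_floorTo_inflate` — in mod-1's interval vocabulary the half-width of
  `pads(floorTo(hull, F))` is `max (halfWidth hull) F + r`: FLOOR enters by `max`, a pad by `+`
  (`floorTo` is itself an `inflate`, and `inflate_inflate` adds radii); `entry_mem_inflateBy_of_mul`
  — at `Entry` level INFL-P is an `Entry.inflateBy` on the floored entry of record.
-/

namespace NonemptyInterval

/-- Half-width of an inflated interval: `halfWidth (I.inflate r) = halfWidth I + r`. [folklore] -/
theorem halfWidth_inflate (I : NonemptyInterval ℚ) (r : ℚ≥0) :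
    (I.inflate r).halfWidth = I.halfWidth + r := by
  unfold halfWidth
  simp only [fst_inflate, snd_inflate]
  ring

/-- **FLOOR by `max`, pad by `+`.** The half-width of the floored-then-padded interval
`(I.floorTo F).inflate r` is `max (halfWidth I) F + r` (ROUTER v0.5 §4.3 (2)–(3); BOX-SCHEMA R2):
the floor is a minimum half-width, a declared pad is added on top of whatever the floor produced —
the two are never compared with each other. [folklore] -/
theorem halfWidth_floorTo_inflate (I : NonemptyInterval ℚ) (F r : ℚ≥0) :
    ((I.floorTo F).inflate r).halfWidth = max I.halfWidth (F : ℚ) + r := by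
  rw [halfWidth_inflate]
  have h1 : (I.floorTo F).halfWidth = I.halfWidth + max 0 ((F : ℚ) - I.halfWidth) := by
    show ((I.floorTo F).snd - (I.floorTo F).fst) / 2 = _
    rw [(floorTo_ends I F).1, (floorTo_ends I F).2]
    unfold halfWidth
    ring
  rw [h1]
  congr 1
  rcases le_total ((F : ℚ) - I.halfWidth) 0 with h | h
  · rw [max_eq_left h, add_zero, max_eq_left (by linarith)]
  · rw [max_eq_right h, max_eq_right (by linarith)]
    ring

end NonemptyInterval

namespace Summit.Ventures.CertifiedManyBodySolver.Downfold.Inflation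

open Real Set

/-! ### §1 Widths of consecutive stages add in log -/

/-- **Consecutive stages compose additively in log.** If the method stage moves a positive quantity
by at most `F` in log (`|log y − log x| ≤ F`) and the structure stage by at most `s`
(`|log z − log y| ≤ s`), the two together move it by at most `F + s`. [folklore] -/
theorem abs_log_sub_log_le_add {x y z F s : ℝ} (hF : |Real.log y - Real.log x| ≤ F)
    (hs : |Real.log z - Real.log y| ≤ s) : |Real.log z - Real.log x| ≤ F + s := by
  have h := abs_sub_le (Real.log z) (Real.log y) (Real.log x)
  linarith

/-- **Log width ⇒ multiplicative bounds**: `0 < ρ`, `|log ρ| ≤ s` ⇒ `e^{-s} ≤ ρ ≤ e^{s}`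
(INFLATION-RULES §P.0: `X ∈ X₀·[e^{-s}, e^{s}]`). [folklore] -/
theorem exp_neg_le_of_abs_log_le {ρ s : ℝ} (hρ : 0 < ρ) (h : |Real.log ρ| ≤ s) :
    Real.exp (-s) ≤ ρ ∧ ρ ≤ Real.exp s := by
  obtain ⟨h1, h2⟩ := abs_le.1 h
  constructor
  · calc Real.exp (-s) ≤ Real.exp (Real.log ρ) := Real.exp_le_exp.2 h1
      _ = ρ := Real.exp_log hρ
  · calc ρ = Real.exp (Real.log ρ) := (Real.exp_log hρ).symm
      _ ≤ Real.exp s := Real.exp_le_exp.2 h2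

/-! ### §2 The multiplicative pad, end-point-wise -/

/-- **Multiplicative pad, interval form.** If `x ∈ [lo, hi]` with `0 ≤ lo` (the floored hull of a
positive coordinate) and the structure stage multiplies by `ρ ∈ [ρlo, ρhi]` with `0 ≤ ρlo`, then
`x ρ ∈ [lo ρlo, hi ρhi]`. [folklore] -/
theorem mul_mem_Icc_mul {x ρ lo hi ρlo ρhi : ℝ} (hx : x ∈ Icc lo hi) (hρ : ρ ∈ Icc ρlo ρhi)
    (hlo : 0 ≤ lo) (hρlo : 0 ≤ ρlo) : x * ρ ∈ Icc (lo * ρlo) (hi * ρhi) := by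
  obtain ⟨hx1, hx2⟩ := hx
  obtain ⟨hρ1, hρ2⟩ := hρ
  have hx0 : 0 ≤ x := hlo.trans hx1
  have hρ0 : 0 ≤ ρ := hρlo.trans hρ1
  exact ⟨mul_le_mul hx1 hρ1 hρlo hx0, mul_le_mul hx2 hρ2 hρ0 (hx0.trans hx2)⟩

/-- **Printed (additive) form of the multiplicative pad** (BOX-SCHEMA R3: `minus` computed from
`lo`, `plus` from `hi`): any `m ≥ lo (1 − ρlo)` and `p ≥ hi (ρhi − 1)` give the enclosure
`x ρ ∈ [lo − m, hi + p]`. [folklore] -/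
theorem mul_mem_Icc_sub_add {x ρ lo hi ρlo ρhi m p : ℝ} (hx : x ∈ Icc lo hi)
    (hρ : ρ ∈ Icc ρlo ρhi) (hlo : 0 ≤ lo) (hρlo : 0 ≤ ρlo) (hm : lo * (1 - ρlo) ≤ m)
    (hp : hi * (ρhi - 1) ≤ p) : x * ρ ∈ Icc (lo - m) (hi + p) := by
  obtain ⟨h1, h2⟩ := mul_mem_Icc_mul hx hρ hlo hρlo
  constructor <;> linarith

/-- **One symmetric radius suffices for soundness**: under the same hypotheses
`|x ρ − x| ≤ hi · max (1 − ρlo) (ρhi − 1)` (the form `Entry.inflateBy` consumes). [folklore] -/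
theorem abs_mul_sub_self_le {x ρ lo hi ρlo ρhi : ℝ} (hx : x ∈ Icc lo hi) (hρ : ρ ∈ Icc ρlo ρhi)
    (hlo : 0 ≤ lo) : |x * ρ - x| ≤ hi * max (1 - ρlo) (ρhi - 1) := by
  obtain ⟨hx1, hx2⟩ := hx
  obtain ⟨hρ1, hρ2⟩ := hρ
  have hx0 : 0 ≤ x := hlo.trans hx1
  have hhi : 0 ≤ hi := hx0.trans hx2
  rw [show x * ρ - x = x * (ρ - 1) by ring, abs_mul, abs_of_nonneg hx0]
  refine mul_le_mul hx2 ?_ (abs_nonneg _) hhi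
  rw [abs_le]
  constructor
  · have := le_max_left (1 - ρlo) (ρhi - 1)
    linarith
  · have := le_max_right (1 - ρlo) (ρhi - 1)
    linarith

/-! ### §3 "Whichever is wider governs" is not an enclosure rule; the composition is -/

/-- **The `max` reading fails.** For any floor `F > 0` and pad `p > 0` there are a value at the
floor edge (`x = 1 + F ∈ [1 − F, 1 + F]`) and a structure factor at the pad edge
(`ρ = 1 + p ∈ [1, 1 + p]`) whose product `1 + F + p + F p` lies OUTSIDE `[1 − max F p, 1 + max F p]`.
[folklore] -/
theorem exists_mul_not_mem_Icc_max {F p : ℝ} (hF : 0 < F) (hp : 0 < p) :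
    ∃ x ρ : ℝ, x ∈ Icc (1 - F) (1 + F) ∧ ρ ∈ Icc 1 (1 + p) ∧
      x * ρ ∉ Icc (1 - max F p) (1 + max F p) := by
  refine ⟨1 + F, 1 + p, ⟨by linarith, le_rfl⟩, ⟨by linarith, le_rfl⟩, ?_⟩
  intro h
  have h2 := h.2
  have hmax : max F p ≤ F + p := max_le (by linarith) (by linarith)
  nlinarith [mul_pos hF hp]

/-- **The composed interval encloses** in the same normalised setting: `x ∈ [1 − F, 1 + F]`,
`ρ ∈ [1, 1 + p]`, `F ≤ 1` ⇒ `x ρ ∈ [1 − F, (1 + F)(1 + p)]` — the upper pad is computed from the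
upper END POINT (`(1 + F) p`, BOX-SCHEMA R3), not from the midpoint. [folklore] -/
theorem mul_mem_Icc_composed {F p x ρ : ℝ} (hF1 : F ≤ 1)
    (hx : x ∈ Icc (1 - F) (1 + F)) (hρ : ρ ∈ Icc 1 (1 + p)) :
    x * ρ ∈ Icc (1 - F) ((1 + F) * (1 + p)) := by
  have h := mul_mem_Icc_mul hx hρ (by linarith) zero_le_one
  simpa only [mul_one] using h

/-! ### §4 Entry level: INFL-P is an `Entry.inflateBy` on the floored entry of record -/

/-- **INFL-P at `Entry` level.** If the entry of record `e` (hull, floored: its claimed enclosure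
`e.encl`) encloses the value `x` computed at the DFT structure, `e.encl` is nonnegative, and the
real structure multiplies the coordinate by `ρ ∈ [ρlo, ρhi]`, then `e.inflateBy r g` encloses
`x ρ` for every declared radius `r ≥ e.encl.snd · max (1 − ρlo) (ρhi − 1)`; by `Entry.encl_inflateBy`
and `NonemptyInterval.inflate_inflate` this radius ADDS to the floor top-up inside `e.infl`.
[folklore] -/
theorem entry_mem_inflateBy_of_mul {e : Entry} (g : Grade) {x ρ ρlo ρhi : ℝ} {r : ℚ≥0}
    (hx : e.Mem x) (h0 : (0 : ℚ) ≤ e.encl.fst) (hρ : ρ ∈ Icc ρlo ρhi)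
    (hr : ((e.encl.snd : ℚ) : ℝ) * max (1 - ρlo) (ρhi - 1) ≤ ((r : ℚ) : ℝ)) :
    (e.inflateBy r g).Mem (x * ρ) := by
  have hx' : ((e.encl.fst : ℚ) : ℝ) ≤ x ∧ x ≤ ((e.encl.snd : ℚ) : ℝ) :=
    NonemptyInterval.mem_ratCast_iff.1 hx
  have h0' : (0 : ℝ) ≤ ((e.encl.fst : ℚ) : ℝ) := by exact_mod_cast h0
  have hb := abs_mul_sub_self_le ⟨hx'.1, hx'.2⟩ hρ h0'
  exact Entry.mem_inflateBy_of_abs_sub_le g hx (hb.trans hr)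

end Summit.Ventures.CertifiedManyBodySolver.Downfold.Inflation
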